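import Literature.Computability.AlgebraicComplexity.PITLanguageCompression
import Literature.Computability.AlgebraicComplexity.CircuitCodeZeroTest
import Literature.Computability.AlgebraicComplexity.ArithCircuitSkeletonRename
import Literature.Computability.Complexity.SumcheckMAReferee
import HarnessLib

/-!
# `PITLanguage ∈ coRP`: identity testing of integer arithmetic circuits is in `coRP`
# (Ibarra–Moran 1983; Kabanets–Impagliazzo 2003, Lemma 8), unconditionally, for the tree's code

Trunk AC (`ValiantBooleanBridge.lean`: `PITLanguage`, the code words `⟨bin n, ⟨C⟩⟩` of pairs `⟨n, C⟩`,
`C` a division-free arithmetic circuit over `ℤ` in `n` variables with `C.eval = 0`;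
`PITLanguageCompression.lean`; `CircuitCodeReading.lean`; `CircuitCodeModularEvaluator.lean`;
`CircuitCodeZeroTest.lean`; `Complexity/RPClosureProofs.lean`; `Complexity/CodeFP.lean`; the total list reader
`SumcheckMA.decNilC` of `Complexity/SumcheckMAReferee.lean`).

**Main results** (all proved, no named fact):

* **`PITLanguage_mem_coRP : PITLanguage ∈ coRP`** and `PITLanguage_mem_BPP : PITLanguage ∈ BPP` — "ACIT
  over `ℤ` is in `coRP`" (Kabanets–Impagliazzo, STOC 2003, Lemma 8, p. 357, citing Ibarra–Moran 1983;
  Schwartz 1980): the FULL language, every string an instance;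
* `PITLanguage_karpReducible_semPolyZero'` — `PITLanguage ≤ₚ {w | CircuitCode.semPoly w = 0}`,
  unconditionally;
* the `coRP` test itself is `CircuitCode.semPolyZero_mem_coRP` (`CircuitCodeZeroTest.lean`: the zero
  set of the junk-tolerant circuit-code semantics is in `coRP` by the randomised modular zero test
  `ModularZeroTest.mem_coRP_of_modularZeroTest_height` — random point of `[0, 2^k)^V`, random `K`-bit
  modulus — with the `FP` evaluator `CircuitCode.evalF`), imported, not re-proved.

**The architecture** is that of the printed one-line proof ("parse the string as a circuit, then run
the Schwartz–Zippel / Ibarra–Moran test"), split along the tree's bricks: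
`PITLanguage_karpReducible_semPolyZero` (`PITLanguageCompression.lean`) reduces `PITLanguage` to the
zero set of `semPoly` (which reads a word of length `ℓ` as a circuit over `ℓ` variables, so an instance
`⟨n, C⟩` is first COMPRESSED to `⟨|C.operands|, C.compress⟩`, renaming `x_i` to `x_{slot i}`) modulo two
polynomial-time WRITERS, which are the bulk of this file:

* `pitDecode w = ⟨⟦fstF w⟧, rdCircuit ⟦fstF w⟧ w⟩`, the total decoder of `pitInstanceEncoding` on the
  junk-tolerant reader `CircuitCode.rdCircuit` (`pitDecode_encode`), and **`pitDecode_codeFP :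
  CodeFP strE pitInstanceEncoding.encode pitDecode`** — the canonical re-encoding `w ↦ code (pitDecode w)`
  is in `FP` (so "`w` is a code word" is the polynomial-time test `code (pitDecode w) = w`). It is
  assembled TYPED in the `CodeFP` calculus: the integer read off a coefficient code (`rdInt_codeFP`),
  the canonical operand code `opCanon (V, u) = opCode V (rdOp V u)` (three head-bit branches,
  `opCanon_eq`), the canonical gate code `gateCanon (V, g) = gateCode V (rdGate V g)` (a `CodeFP.map` over
  the items `rdItems g` with the context `V`), the word (`encodeArithCircuit_eq`);
* **`pitCompress_codeFP : CodeFP pitInstanceEncoding.encode pitInstanceEncoding.encode pitCompress`** —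
  collect the operand codes (`opCodesOf`; on a circuit word, the codes of `C.operands`), replace every
  variable code `00·bin i` by `00·bin (min (first occurrence) (|operands| - 1))` (`reOp`; `opCode n` is
  injective, so first occurrences of codes are first occurrences of operands, and this is the code of
  `x_{slotIdx i}`), rebuild gates and header (`reWord_circuitWord`); the first-occurrence scan is a
  `CodeFP.foldl` (`idxOf_codeFP`).

Both writers are the routine syntactic polynomial-time maps of Kabanets–Impagliazzo 2004, §2 (circuits
as strings). HONEST FRAMING: a textbook membership (`ACIT ∈ coRP`) for the tree's concrete encoding;
`VP ≠ VNP` is NOT proved and nothing here bears on it. Consumers: `BIJL2018_thm5_of_PIT_mem_BPP`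
(`Barriers/ValiantsHypothesis/BIJL18Thm5OfRandomizedPIT.lean`), the BILPS 2019 Cor. 42 edge programme.

## References

* V. Kabanets, R. Impagliazzo, *Derandomizing polynomial identity tests means proving circuit lower
  bounds*, STOC 2003, §2.3 (ACIT) and Lemma 8 p. 357 ("ACIT over ℤ is in coRP") [KabanetsImpagliazzo2003];
  Comput. Complexity 13 (2004) 1–46, §2 (arithmetic circuits as strings) [KabanetsImpagliazzo2004].
* O. H. Ibarra, S. Moran, *Probabilistic algorithms for deciding equivalence of straight-line programs*,
  J. ACM 30 (1983) 217–228, §4 [IbarraMoran1983].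
* J. T. Schwartz, *Fast probabilistic algorithms for verification of polynomial identities*, J. ACM 27
  (1980) 701–717, Cor. 1 and §3 [Schwartz1980].
* S. Arora, B. Barak, *Computational Complexity: A Modern Approach*, CUP 2009, §0.1 (codes of tuples and
  lists), §1.3 (closure of polynomial time under composition and bounded loops), Lemma 7.5 and §7.2.3
  [AroraBarakCC2009].
-/

noncomputable section

namespace Literature.Computability.AlgebraicComplexity

open _root_.Computability
open Literature.Computability.Complexity Literature.Computability.Complexity.CodeFP
open Literature.Computability.Complexity.Brick
open scoped Literature.Computability.Complexity.Notation
open ArithCircuit CircuitCode KIReduction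

namespace PITCodeFP

/-! ### String-level `CodeFP` kit (projections, head bit, tail, cons) -/

/-- First pair component, on strings. [folklore] -/
private theorem strFst : CodeFP strE strE fstF := of_fn fstF fstF_mem_FP fun _ => rfl

/-- Second pair component, on strings. [folklore] -/
private theorem strSnd : CodeFP strE strE sndF := of_fn sndF sndF_mem_FP fun _ => rfl

/-- Tail of a string. [folklore] -/
private theorem strTail : CodeFP strE strE List.tail := of_fn List.tail PRelSigma.tail_mem_FP fun _ => rfl

/-- Head bit of a string (`false` on `ε`). [folklore] -/
private theorem strHeadD : CodeFP strE bitE (fun s => s.headD false) :=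
  of_fn HashBricks.headBitFn HashBricks.headBitFn_mem_FP fun s => by
    rw [HashBricks.headBitFn_apply]; rfl

/-- Prepending a fixed bit. [folklore] -/
private theorem strCons (b : Bool) : CodeFP strE strE (List.cons b) :=
  of_fn (List.cons b) (cons_mem_FP b) fun _ => rfl

/-- Pairing two strings. [folklore] -/
private theorem strPair : CodeFP (pairE strE strE) strE (fun p => boolPair p.1 p.2) := recode fun _ => rfl

/-- A raw list of strings IS its `encList`. [folklore] -/
private theorem rawE_strE (l : List (List Bool)) : rawE strE l = encList l := by
  rw [rawE, show (strE : List Bool → List Bool) = id from rfl, List.map_id]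

/-- A headed list of strings is `⟨1^{|l|}, encList l⟩`. [folklore] -/
private theorem listE_strE (l : List (List Bool)) : listE strE l = boolPair (ones l.length) (encList l) := by
  rw [listE, unE_eq_ones, rawE_strE]

/-! ### Integers and operands read off codes, re-encoded canonically -/

/-- **The integer read off a coefficient code, in polynomial time** (`rdInt`, the sign–magnitude
reading of `⟨[sign], magnitude⟩`). [cite: KabanetsImpagliazzo2004, §2] -/
theorem rdInt_codeFP : CodeFP strE intE rdInt :=
  ((strHeadD.comp strFst).ite (intNeg.comp (intOfNat.comp (strVal.comp strSnd)))
    (intOfNat.comp (strVal.comp strSnd))).congr fun c => by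
    simp only [rdInt]

/-- The canonical code of the integer read off a string: `intCode (rdInt c)`. [cite: KabanetsImpagliazzo2004, §2] -/
theorem intCanon_codeFP : CodeFP strE strE (fun c => intCode (rdInt c)) :=
  (smOfInt.comp rdInt_codeFP).recodeOut fun _ => rfl

/-- **The canonical operand code** over `V` variables of a string: `opCode V (rdOp V u)`.
[cite: KabanetsImpagliazzo2004, §2] -/
def opCanon (p : ℕ × List Bool) : List Bool := opCode p.1 (rdOp p.1 p.2)

/-- Closed form of `opCanon` by the two head bits. [cite: KabanetsImpagliazzo2004, §2] -/
theorem opCanon_eq (V : ℕ) (u : List Bool) :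
    opCanon (V, u) =
      if u.headD false then true :: natE (bitsToNat u.tail)
      else if u.tail.headD false then false :: true :: intCode (rdInt u.tail.tail)
      else if bitsToNat u.tail.tail < V then false :: false :: natE (bitsToNat u.tail.tail)
      else false :: true :: intCode 0 := by
  show opCode V (rdOp V u) = _
  unfold rdOp
  by_cases h0 : u.headD false = true
  · rw [if_pos h0, if_pos h0]; rfl
  · rw [if_neg h0, if_neg h0]
    by_cases h1 : u.tail.headD false = true
    · rw [if_pos h1, if_pos h1]; rfl
    · rw [if_neg h1, if_neg h1]
      by_cases h2 : bitsToNat u.tail.tail < V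
      · rw [dif_pos h2, if_pos h2]; rfl
      · rw [dif_neg h2, if_neg h2]; rfl

/-- **`opCanon` is computed in polynomial time on codes.** [cite: KabanetsImpagliazzo2004, §2] -/
theorem opCanon_codeFP : CodeFP (pairE natE strE) strE opCanon := by
  have hu : CodeFP (pairE natE strE) strE (fun p => p.2) := snd _ _
  have hV : CodeFP (pairE natE strE) natE (fun p => p.1) := fst _ _
  have hut : CodeFP (pairE natE strE) strE (fun p => p.2.tail) := strTail.comp hu
  have hutt : CodeFP (pairE natE strE) strE (fun p => p.2.tail.tail) := strTail.comp hut
  have h := (strHeadD.comp hu).ite ((strCons true).comp (strOfNat.comp (strVal.comp hut)))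
    ((strHeadD.comp hut).ite ((strCons false).comp ((strCons true).comp (intCanon_codeFP.comp hutt)))
      ((natLt.comp ((strVal.comp hutt).pair hV)).ite
        ((strCons false).comp ((strCons false).comp (strOfNat.comp (strVal.comp hutt))))
        (const (pairE natE strE) (false :: true :: intCode 0))))
  refine h.congr fun p => ?_
  obtain ⟨V, u⟩ := p
  rw [opCanon_eq]
  dsimp only
  simp only [decide_eq_true_eq]

/-! ### Gates and whole words, re-encoded canonically: the decoder `pitDecode` -/

/-- The argument items of a gate code, as a raw list, in polynomial time. [cite: KabanetsImpagliazzo2004, §2] -/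
theorem rdItems_codeFP : CodeFP strE (rawE strE) rdItems :=
  (SumcheckMA.decNilC.comp (strSnd.comp strTail)).congr fun _ => rfl

/-- **The canonical gate code** over `V` variables of a string: `gateCode V (rdGate V g)`.
[cite: KabanetsImpagliazzo2004, §2] -/
def gateCanon (p : ℕ × List Bool) : List Bool := gateCode p.1 (rdGate p.1 p.2)

/-- Closed form of `gateCanon` by the tag bit. [cite: KabanetsImpagliazzo2004, §2] -/
theorem gateCanon_eq (V : ℕ) (g : List Bool) :
    gateCanon (V, g) =
      if g.headD false then true :: listE strE ((rdItems g).map fun u => opCanon (V, u))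
      else false :: listE strE ((rdItems g).map fun it =>
        boolPair (intCode (rdInt (fstF it))) (opCanon (V, sndF it))) := by
  show gateCode V (rdGate V g) = _
  unfold rdGate
  by_cases h : g.headD false = true
  · rw [if_pos h, if_pos h, gateCode_prod, listE_strE, List.length_map, List.length_map, List.map_map]; rfl
  · rw [if_neg h, if_neg h, gateCode_sum, listE_strE, List.length_map, List.length_map, List.map_map]; rfl

/-- **`gateCanon` is computed in polynomial time on codes** (a `map` over the items with the context
`V`). [cite: KabanetsImpagliazzo2004, §2] [cite: AroraBarakCC2009, §1.3] -/
theorem gateCanon_codeFP : CodeFP (pairE natE strE) strE gateCanon := by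
  have hg : CodeFP (pairE natE strE) strE (fun p => p.2) := snd _ _
  have hV : CodeFP (pairE natE strE) natE (fun p => p.1) := fst _ _
  have hitems : CodeFP (pairE natE strE) (pairE natE (rawE strE)) (fun p => (p.1, rdItems p.2)) :=
    hV.pair (rdItems_codeFP.comp hg)
  have hprod : CodeFP (pairE natE strE) strE
      (fun p => true :: listE strE ((rdItems p.2).map fun u => opCanon (p.1, u))) :=
    (strCons true).comp (((listOfRaw strE).comp ((map opCanon_codeFP).comp hitems)).recodeOut
      (eγ := strE) fun _ => rfl)
  have hitem : CodeFP (pairE natE strE) strE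
      (fun q => boolPair (intCode (rdInt (fstF q.2))) (opCanon (q.1, sndF q.2))) :=
    strPair.comp ((intCanon_codeFP.comp (strFst.comp (snd _ _))).pair
      (opCanon_codeFP.comp ((fst _ _).pair (strSnd.comp (snd _ _)))))
  have hsum : CodeFP (pairE natE strE) strE
      (fun p => false :: listE strE ((rdItems p.2).map fun it =>
        boolPair (intCode (rdInt (fstF it))) (opCanon (p.1, sndF it)))) :=
    (strCons false).comp (((listOfRaw strE).comp ((map hitem).comp hitems)).recodeOut
      (eγ := strE) fun _ => rfl)
  refine ((strHeadD.comp hg).ite hprod hsum).congr fun p => ?_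
  obtain ⟨V, g⟩ := p
  rw [gateCanon_eq]

/-- Renaming along the identity. [cite: Burgisser2000, Def. 2.1] -/
theorem rename_id_eq {σ : Type} (C : ArithCircuit ℤ σ) : C.rename id = C := by
  have h : (Gate.rename id : Gate ℤ σ → Gate ℤ σ) = id := funext Gate.rename_id'
  cases C
  simp only [ArithCircuit.rename, h, List.map_id, Operand.rename_id']

/-- **The total decoder of `pitInstanceEncoding`**: the number of variables `V = ⟦fstF w⟧` and the
circuit over `V` variables read off `w` by the junk-tolerant reader. [cite: KabanetsImpagliazzo2004, §2] -/
def pitDecode (w : List Bool) : Σ n : ℕ, ArithCircuit ℤ (Fin n) :=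
  ⟨bitsToNat (fstF w), rdCircuit (bitsToNat (fstF w)) w⟩

/-- `pitDecode` decodes code words. [cite: KabanetsImpagliazzo2004, §2] -/
theorem pitDecode_encode (p : Σ n : ℕ, ArithCircuit ℤ (Fin n)) :
    pitDecode (pitInstanceEncoding.encode p) = p := by
  obtain ⟨n, C⟩ := p
  have key : ∀ V : ℕ, V = n →
      (⟨V, rdCircuit V (pitInstanceEncoding.encode ⟨n, C⟩)⟩ : Σ n : ℕ, ArithCircuit ℤ (Fin n)) = ⟨n, C⟩ := by
    rintro V rfl
    rw [← circuitWord_eq_encode, rdCircuit_circuitWord le_rfl]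
    have hid : (Fin.castLE (le_refl V) : Fin V → Fin V) = id := funext fun i => Fin.ext rfl
    rw [hid, rename_id_eq]
  apply key
  rw [← circuitWord_eq_encode, circuitWord, fstF_boolPair, bitsToNat_encodeNat]

/-- The code of the decoded instance, spelled out. [cite: KabanetsImpagliazzo2004, §2] -/
theorem encode_pitDecode (w : List Bool) :
    pitInstanceEncoding.encode (pitDecode w) =
      boolPair (natE (bitsToNat (fstF w)))
        (boolPair (listE strE ((rdGateCodes w).map fun g => gateCanon (bitsToNat (fstF w), g)))
          (opCanon (bitsToNat (fstF w), rdOutCode w))) := by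
  rw [pitDecode, ← circuitWord_eq_encode, circuitWord, encodeArithCircuit_eq, listE_strE, List.length_map]
  simp only [rdCircuit, List.map_map, List.length_map]
  rfl

/-- The gate codes of a word, as a raw list, in polynomial time. [cite: KabanetsImpagliazzo2004, §2] -/
theorem rdGateCodes_codeFP : CodeFP strE (rawE strE) rdGateCodes :=
  (SumcheckMA.decNilC.comp (strSnd.comp (strFst.comp strSnd))).congr fun _ => rfl

/-- The output operand code of a word, in polynomial time. [cite: KabanetsImpagliazzo2004, §2] -/
theorem rdOutCode_codeFP : CodeFP strE strE rdOutCode := (strSnd.comp strSnd).congr fun _ => rfl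

end PITCodeFP

open PITCodeFP

/-- **The canonical re-encoding `w ↦ code (pitDecode w)` is in `FP`** — the first writer of
`PITLanguage_karpReducible_semPolyZero`. [cite: KabanetsImpagliazzo2004, §2] [cite: AroraBarakCC2009, §1.3] -/
theorem pitDecode_codeFP : CodeFP strE pitInstanceEncoding.encode pitDecode := by
  have hV : CodeFP strE natE (fun w => bitsToNat (fstF w)) := strVal.comp strFst
  have hgates : CodeFP strE strE
      (fun w => listE strE ((rdGateCodes w).map fun g => gateCanon (bitsToNat (fstF w), g))) :=
    ((listOfRaw strE).comp ((map gateCanon_codeFP).comp (hV.pair rdGateCodes_codeFP))).recodeOut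
      (eγ := strE) fun _ => rfl
  have hout : CodeFP strE strE (fun w => opCanon (bitsToNat (fstF w), rdOutCode w)) :=
    opCanon_codeFP.comp (hV.pair rdOutCode_codeFP)
  exact (strPair.comp ((strOfNat.comp hV).pair (strPair.comp (hgates.pair hout)))).recodeOut fun w => by
    rw [encode_pitDecode]; rfl

namespace PITCodeFP

/-! ### The compression on codes: operand codes, first occurrences, re-indexed variables -/

variable {n : ℕ}

/-- The operand codes of a gate code: the items of a product code, the second fields of the items
of a sum code. [cite: KabanetsImpagliazzo2004, §2] -/
def gateOpCodes (g : List Bool) : List (List Bool) :=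
  if g.headD false then rdItems g else (rdItems g).map sndF

/-- **The operand codes of a word**: those of its gates, in order, then the output code.
[cite: KabanetsImpagliazzo2004, §2] -/
def opCodesOf (w : List Bool) : List (List Bool) :=
  ((rdGateCodes w).map gateOpCodes).flatten ++ [rdOutCode w]

/-- The items of a product-gate code. [cite: KabanetsImpagliazzo2004, §2] -/
theorem rdItems_gateCode_prod (m : ℕ) (args : List (Operand ℤ (Fin m))) :
    rdItems (gateCode m (.prod args)) = args.map (opCode m) := by
  rw [gateCode_prod, rdItems, List.tail_cons, sndF_boolPair, decNil_encList]

/-- The items of a sum-gate code. [cite: KabanetsImpagliazzo2004, §2] -/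
theorem rdItems_gateCode_sum (m : ℕ) (args : List (ℤ × Operand ℤ (Fin m))) :
    rdItems (gateCode m (.sum args)) = args.map fun a => boolPair (intCode a.1) (opCode m a.2) := by
  rw [gateCode_sum, rdItems, List.tail_cons, sndF_boolPair, decNil_encList]

/-- The operand codes of a gate code are the codes of its operands. [cite: KabanetsImpagliazzo2004, §2] -/
theorem gateOpCodes_gateCode (m : ℕ) (g : Gate ℤ (Fin m)) :
    gateOpCodes (gateCode m g) = g.args.map (opCode m) := by
  cases g with
  | sum args =>
    have h : (gateCode m (.sum args)).headD false = false := by rw [gateCode_sum]; rfl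
    rw [gateOpCodes, h, rdItems_gateCode_sum, List.map_map, ArithCircuit.Gate.args, List.map_map]
    simp only [Bool.false_eq_true, if_false]
    exact List.map_congr_left fun a _ => by simp
  | prod args =>
    have h : (gateCode m (.prod args)).headD false = true := by rw [gateCode_prod]; rfl
    rw [gateOpCodes, h, if_pos rfl, rdItems_gateCode_prod, ArithCircuit.Gate.args]

/-- `flatten ∘ map = flatMap`. [folklore] -/
private theorem flatten_map_eq_flatMap {α β : Type} (f : α → List β) (l : List α) :
    (l.map f).flatten = l.flatMap f := by
  induction l with
  | nil => rfl
  | cons a l ih => simp [ih]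

/-- **The operand codes of a circuit word are the codes of its operand list.** [cite: KabanetsImpagliazzo2004, §2] -/
theorem opCodesOf_circuitWord (C : ArithCircuit ℤ (Fin n)) :
    opCodesOf (circuitWord n C) = C.operands.map (opCode n) := by
  rw [opCodesOf, rdGateCodes_circuitWord, rdOutCode_circuitWord, operands, List.map_append, List.map_cons,
    List.map_nil, List.map_map, flatten_map_eq_flatMap, List.map_flatMap]
  congr 1
  exact List.flatMap_congr fun g _ => by rw [Function.comp_apply, gateOpCodes_gateCode]

/-- First occurrences are preserved by an injective map. [folklore] -/
private theorem idxOf_map_of_injective {α β : Type} [BEq α] [LawfulBEq α] [BEq β] [LawfulBEq β] {f : α → β}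
    (hf : Function.Injective f) (a : α) (l : List α) : (l.map f).idxOf (f a) = l.idxOf a := by
  induction l with
  | nil => rfl
  | cons b l ih =>
    rw [List.map_cons]
    by_cases h : b = a
    · subst h; rw [List.idxOf_cons_self, List.idxOf_cons_self]
    · have h' : f b ≠ f a := fun e => h (hf e)
      rw [List.idxOf_cons_ne _ h', List.idxOf_cons_ne _ h, ih]

/-- First occurrences of operand codes are first occurrences of operands (`opCode m` is injective).
[cite: KabanetsImpagliazzo2004, §2] -/
theorem idxOf_map_opCode (l : List (Operand ℤ (Fin n))) (u : Operand ℤ (Fin n)) :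
    (l.map (opCode n)).idxOf (opCode n u) = l.idxOf u :=
  idxOf_map_of_injective (operandEncoding n).encode_injective u l

/-- The test "is the code of a variable" (`00·…`). [cite: KabanetsImpagliazzo2004, §2] -/
def isVarCode (u : List Bool) : Bool := !(u.headD false) && !(u.tail.headD false)

/-- **Re-indexing an operand code** against the list of operand codes: a variable code `00·bin i`
becomes `00·bin (min (first occurrence) (|ops| - 1))`, other codes are kept. [cite: KabanetsImpagliazzo2004, §2] -/
def reOp (ops : List (List Bool)) (u : List Bool) : List Bool :=
  if isVarCode u then false :: false :: natE (min (ops.idxOf u) (ops.length - 1)) else u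

/-- **Re-indexing the code of an operand of `C` gives the code of the operand of `compress C`.**
[cite: KabanetsImpagliazzo2004, §2] -/
theorem reOp_opCode (C : ArithCircuit ℤ (Fin n)) (u : Operand ℤ (Fin n)) :
    reOp (C.operands.map (opCode n)) (opCode n u) = opCode C.operands.length (u.rename C.slotIdx) := by
  cases u with
  | var i =>
    rw [reOp, idxOf_map_opCode, List.length_map, show isVarCode (opCode n (.var i)) = true from rfl, if_pos rfl]
    rfl
  | const c => rfl
  | gate j => rfl

/-- **Re-indexing a gate code.** [cite: KabanetsImpagliazzo2004, §2] -/
def reGate (ops : List (List Bool)) (g : List Bool) : List Bool :=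
  if g.headD false then true :: listE strE ((rdItems g).map (reOp ops))
  else false :: listE strE ((rdItems g).map fun it => boolPair (fstF it) (reOp ops (sndF it)))

/-- Re-indexing the code of a gate of `C` gives the code of the gate of `compress C`. [cite: KabanetsImpagliazzo2004, §2] -/
theorem reGate_gateCode (C : ArithCircuit ℤ (Fin n)) (g : Gate ℤ (Fin n)) :
    reGate (C.operands.map (opCode n)) (gateCode n g) = gateCode C.operands.length (g.rename C.slotIdx) := by
  cases g with
  | sum args =>
    have h : (gateCode n (.sum args)).headD false = false := by rw [gateCode_sum]; rfl
    rw [reGate, h, rdItems_gateCode_sum, Gate.rename, gateCode_sum]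
    simp only [Bool.false_eq_true, if_false, listE_strE, List.length_map, List.map_map]
    refine congrArg (List.cons false) (congrArg₂ boolPair rfl (congrArg encList (List.map_congr_left fun a _ => ?_)))
    simp only [Function.comp_apply, fstF_boolPair, sndF_boolPair, reOp_opCode]
  | prod args =>
    have h : (gateCode n (.prod args)).headD false = true := by rw [gateCode_prod]; rfl
    rw [reGate, h, if_pos rfl, rdItems_gateCode_prod, Gate.rename, gateCode_prod]
    simp only [listE_strE, List.length_map, List.map_map]
    refine congrArg (List.cons true) (congrArg₂ boolPair rfl (congrArg encList (List.map_congr_left fun a _ => ?_)))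
    simp only [Function.comp_apply, reOp_opCode]

/-- **The compression on strings**: new header `|ops|`, re-indexed gates and output. [cite: KabanetsImpagliazzo2004, §2] -/
def reWord (w : List Bool) : List Bool :=
  boolPair (natE (opCodesOf w).length)
    (boolPair (listE strE ((rdGateCodes w).map (reGate (opCodesOf w)))) (reOp (opCodesOf w) (rdOutCode w)))

/-- **On a circuit word, `reWord` writes the word of the compressed circuit.** [cite: KabanetsImpagliazzo2004, §2] -/
theorem reWord_circuitWord (C : ArithCircuit ℤ (Fin n)) :
    reWord (circuitWord n C) = circuitWord C.operands.length C.compress := by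
  rw [reWord, opCodesOf_circuitWord, rdGateCodes_circuitWord, rdOutCode_circuitWord, reOp_opCode, circuitWord,
    encodeArithCircuit_eq, compress]
  simp only [List.length_map, List.map_map, listE_strE, ArithCircuit.rename]
  refine congrArg _ (congrArg₂ boolPair (congrArg₂ boolPair rfl (congrArg encList
    (List.map_congr_left fun g _ => ?_))) rfl)
  simp only [Function.comp_apply, reGate_gateCode]

/-! ### The compression is polynomial time on codes -/

/-- The operand codes of a gate code, in polynomial time. [cite: KabanetsImpagliazzo2004, §2] -/
theorem gateOpCodes_codeFP : CodeFP strE (rawE strE) gateOpCodes :=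
  (strHeadD.ite rdItems_codeFP ((map₀ strSnd).comp rdItems_codeFP)).congr fun g => by rw [gateOpCodes]

/-- The operand codes of a word, in polynomial time. [cite: KabanetsImpagliazzo2004, §2] -/
theorem opCodesOf_codeFP : CodeFP strE (rawE strE) opCodesOf :=
  (rawAppend strE).comp (((flatten strE).comp ((map₀ gateOpCodes_codeFP).comp rdGateCodes_codeFP)).pair
    ((rawSingleton strE).comp rdOutCode_codeFP))

/-- The variable-code test, in polynomial time. [cite: KabanetsImpagliazzo2004, §2] -/
theorem isVarCode_codeFP : CodeFP strE bitE isVarCode := strHeadD.not.and (strHeadD.comp strTail).not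

/-- The step of the first-occurrence scan: `(index so far, found?)`. [folklore] -/
def idxStep (s a : List Bool) (st : ℕ × Bool) : ℕ × Bool :=
  if st.2 then st else if a = s then (st.1, true) else (st.1 + 1, false)

/-- Once found, the scan state is frozen. [folklore] -/
private theorem foldl_idxStep_found (s : List Bool) (l : List (List Bool)) (k : ℕ) :
    l.foldl (fun st a => idxStep s a st) (k, true) = (k, true) := by
  induction l with
  | nil => rfl
  | cons a l ih => rw [List.foldl_cons, show idxStep s a (k, true) = (k, true) from rfl, ih]

/-- **Semantics of the scan**: `(k + idxOf s l, s ∈ l)`. [folklore] -/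
private theorem foldl_idxStep (s : List Bool) (l : List (List Bool)) (k : ℕ) :
    l.foldl (fun st a => idxStep s a st) (k, false) = (k + l.idxOf s, decide (s ∈ l)) := by
  induction l generalizing k with
  | nil => simp
  | cons a l ih =>
    rw [List.foldl_cons]
    by_cases h : a = s
    · subst h
      rw [show idxStep a a (k, false) = (k, true) by simp [idxStep], foldl_idxStep_found, List.idxOf_cons_self]
      simp
    · rw [show idxStep s a (k, false) = (k + 1, false) by simp [idxStep, h], ih, List.idxOf_cons_ne _ h]
      have hm : (s ∈ a :: l) ↔ s ∈ l := by simp [Ne.symm h]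
      simp only [hm, Nat.succ_eq_add_one]
      congr 1
      omega

/-- **First occurrence in a raw list of strings, in polynomial time.** [cite: AroraBarakCC2009, §1.3] -/
theorem idxOf_codeFP : CodeFP (pairE strE (rawE strE)) natE (fun p => p.2.idxOf p.1) := by
  have hinj : Function.Injective (strE : List Bool → List Bool) := fun a b h => h
  let tE : List Bool × (List Bool × (ℕ × Bool)) → List Bool := pairE strE (pairE strE (pairE natE bitE))
  have hfound : CodeFP tE bitE (fun t => t.2.2.2) := (snd _ _).snd'.snd'
  have hk : CodeFP tE natE (fun t => t.2.2.1) := (snd _ _).snd'.fst'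
  have heq : CodeFP tE bitE (fun t => decide (t.2.1 = t.1)) := (eq hinj).comp ((snd _ _).fst'.pair (fst _ _))
  have hstep : CodeFP tE (pairE natE bitE) (fun t => idxStep t.1 t.2.1 t.2.2) :=
    (hfound.ite (snd _ _).snd' (heq.ite (hk.pair (const tE true))
      ((natAdd.comp (hk.pair (const tE 1))).pair (const tE false)))).congr fun t => by
      simp only [idxStep, decide_eq_true_eq]
  have hinit : CodeFP strE (pairE natE bitE) (fun _ => ((0 : ℕ), false)) := const strE _
  have h := foldl (step := fun s a st => idxStep s a st) (init := fun _ => ((0 : ℕ), false)) hstep hinit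
    (2 * Polynomial.X + 3) (fun s l₁ l₂ => by
      rw [foldl_idxStep, Nat.zero_add, pairE_apply, length_boolPair]
      have h1 : (natE (l₁.idxOf s)).length ≤ l₁.length := (length_natE_le _).trans List.idxOf_le_length
      have h2 : l₁.length ≤ (pairE strE (rawE strE) (s, l₁ ++ l₂)).length := by
        rw [pairE_apply, length_boolPair]
        have := length_le_length_rawE strE (l₁ ++ l₂)
        rw [List.length_append] at this
        simp only
        omega
      simp only [bitE, List.length_singleton, Polynomial.eval_add, Polynomial.eval_mul, Polynomial.eval_ofNat,
        Polynomial.eval_X]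
      omega)
  exact h.fst'.congr fun p => by simp only [foldl_idxStep, Nat.zero_add]

/-- **Re-indexing an operand code, in polynomial time.** [cite: KabanetsImpagliazzo2004, §2] -/
theorem reOp_codeFP : CodeFP (pairE (rawE strE) strE) strE (fun p => reOp p.1 p.2) := by
  have hops : CodeFP (pairE (rawE strE) strE) (rawE strE) (fun p => p.1) := fst _ _
  have hu : CodeFP (pairE (rawE strE) strE) strE (fun p => p.2) := snd _ _
  have hidx : CodeFP (pairE (rawE strE) strE) natE (fun p => min (p.1.idxOf p.2) (p.1.length - 1)) :=
    natMin.comp ((idxOf_codeFP.comp (hu.pair hops)).pair (natSub.comp (((natLength strE).comp hops).pair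
      (const _ 1))))
  exact ((isVarCode_codeFP.comp hu).ite ((strCons false).comp ((strCons false).comp (strOfNat.comp hidx))) hu).congr
    fun p => by rw [reOp]

/-- **Re-indexing a gate code, in polynomial time** (a `map` over the items with the context `ops`).
[cite: KabanetsImpagliazzo2004, §2] [cite: AroraBarakCC2009, §1.3] -/
theorem reGate_codeFP : CodeFP (pairE (rawE strE) strE) strE (fun p => reGate p.1 p.2) := by
  have hg : CodeFP (pairE (rawE strE) strE) strE (fun p => p.2) := snd _ _
  have hops : CodeFP (pairE (rawE strE) strE) (rawE strE) (fun p => p.1) := fst _ _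
  have hitems : CodeFP (pairE (rawE strE) strE) (pairE (rawE strE) (rawE strE)) (fun p => (p.1, rdItems p.2)) :=
    hops.pair (rdItems_codeFP.comp hg)
  have hprod : CodeFP (pairE (rawE strE) strE) strE
      (fun p => true :: listE strE ((rdItems p.2).map (reOp p.1))) :=
    (strCons true).comp (((listOfRaw strE).comp ((map reOp_codeFP).comp hitems)).recodeOut
      (eγ := strE) fun _ => rfl)
  have hitem : CodeFP (pairE (rawE strE) strE) strE (fun q => boolPair (fstF q.2) (reOp q.1 (sndF q.2))) :=
    strPair.comp ((strFst.comp (snd _ _)).pair (reOp_codeFP.comp ((fst _ _).pair (strSnd.comp (snd _ _)))))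
  have hsum : CodeFP (pairE (rawE strE) strE) strE
      (fun p => false :: listE strE ((rdItems p.2).map fun it => boolPair (fstF it) (reOp p.1 (sndF it)))) :=
    (strCons false).comp (((listOfRaw strE).comp ((map hitem).comp hitems)).recodeOut
      (eγ := strE) fun _ => rfl)
  exact ((strHeadD.comp hg).ite hprod hsum).congr fun p => by rw [reGate]

/-- **`reWord` is in `FP`.** [cite: KabanetsImpagliazzo2004, §2] [cite: AroraBarakCC2009, §1.3] -/
theorem reWord_codeFP : CodeFP strE strE reWord := by
  have hops : CodeFP strE (rawE strE) opCodesOf := opCodesOf_codeFP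
  have hhdr : CodeFP strE strE (fun w => natE (opCodesOf w).length) := strOfNat.comp ((natLength strE).comp hops)
  have hgates : CodeFP strE strE (fun w => listE strE ((rdGateCodes w).map (reGate (opCodesOf w)))) :=
    ((listOfRaw strE).comp ((map reGate_codeFP).comp (hops.pair rdGateCodes_codeFP))).recodeOut
      (eγ := strE) fun _ => rfl
  have hout : CodeFP strE strE (fun w => reOp (opCodesOf w) (rdOutCode w)) :=
    reOp_codeFP.comp (hops.pair rdOutCode_codeFP)
  exact (strPair.comp (hhdr.pair (strPair.comp (hgates.pair hout)))).congr fun w => by rw [reWord]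

end PITCodeFP

/-- **The compression `⟨n, C⟩ ↦ ⟨|C.operands|, compress C⟩` is polynomial time on codes** — the second
writer of `PITLanguage_karpReducible_semPolyZero`. [cite: KabanetsImpagliazzo2004, §2] [cite: AroraBarakCC2009, §1.3] -/
theorem pitCompress_codeFP : CodeFP pitInstanceEncoding.encode pitInstanceEncoding.encode pitCompress := by
  obtain ⟨f, hf, hfw⟩ := reWord_codeFP
  refine of_fn f hf fun p => ?_
  obtain ⟨n, C⟩ := p
  rw [← circuitWord_eq_encode, pitCompress, ← circuitWord_eq_encode, ← reWord_circuitWord]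
  exact hfw _

/-! ### The closers -/

/-- **`PITLanguage ≤ₚ {w | semPoly w = 0}`**, unconditionally: the reduction of
`PITLanguage_karpReducible_semPolyZero` with both writers supplied. [cite: KabanetsImpagliazzo2004, §2] -/
theorem PITLanguage_karpReducible_semPolyZero' : PITLanguage ≤ₚ ({w | semPoly w = 0} : Language Bool) :=
  PITLanguage_karpReducible_semPolyZero pitDecode_encode pitDecode_codeFP pitCompress_codeFP

/-- **`PITLanguage ∈ coRP`: identity testing of division-free integer arithmetic circuits is in `coRP`**
("ACIT over `ℤ` is in coRP", Kabanets–Impagliazzo 2003, Lemma 8, after Ibarra–Moran 1983 and Schwartz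
1980) — for the FULL language of the tree's encoding (every string is an instance: non-code-words are
rejected by the canonicity test, code words are compressed and tested modulo a random number at a random
point). [cite: KabanetsImpagliazzo2003, Lemma 8 (p. 357)] [cite: IbarraMoran1983, §4] [cite: Schwartz1980, Cor. 1] -/
theorem PITLanguage_mem_coRP : PITLanguage ∈ coRP :=
  PITLanguage_mem_coRP_of_semPolyZero pitDecode_encode pitDecode_codeFP pitCompress_codeFP semPolyZero_mem_coRP

/-- **`PITLanguage ∈ BPP`** (`coRP ⊆ BPP`). [cite: KabanetsImpagliazzo2003, Lemma 8 (p. 357)] [cite: AroraBarakCC2009, §7.3] -/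
theorem PITLanguage_mem_BPP : PITLanguage ∈ BPP :=
  ofLanguage_mem_PromiseBPP'_iff.1 (PromiseCoRP'_subset_PromiseBPP'
    (ofLanguage_mem_PromiseCoRP'_iff.2 PITLanguage_mem_coRP))

end Literature.Computability.AlgebraicComplexity
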